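import Summits.AtomisticToContinuum.HydrodynamicLimit.Theorems.LambertianContactSwapLambertianEulerDock
import HarnessLib

/-!
# The entropy-clock dock of the Lambertian gas along the EXPLICIT reference (crux `LambertianEuler`, stmt-AtomisticToContinuum-11854, line `Sketch`, stub `stub_dockLambdaRf`)

Stub `stub_dockLambdaRf` of the crux `LambertianEuler` (Euler hydrodynamic limit of the Lambertian
hard-sphere gas `Λ`, law of `Λ_t` under `λ_N ⊗ γ^ℕ`, `lambertFlow` / `lambertNoise`). Yau's node
`RelEntropyVanishingLambda` (the local Gibbs laws are probability measures; given the `t = 0` tie, for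
every `t ∈ [0, T)` an activity profile `a` whose local Gibbs law with `(u t, θ t)` is a probability
measure, concentrates exponentially around the Euler fields `(ρ t, u t, θ t)`, and
`KL(law of Λ_t ‖ that reference)/(N+1) → 0`) is obtained as DOCK ∘ GRONWALL ∘ DILUTE. This file is the
DOCK along the EXPLICIT reference family: its first hypothesis is Yau's relative-entropy estimate along
`a_t := fun x => ρ t x * Rf (σ ^ 3 * ρ t x)` for EVERY insertion factor `Rf` on `(-r, r)` (handed over
with its four defining properties `Rf x · Φ(x Rf x) = 1`, `1 ≤ Rf ≤ 2` and continuity on `[0, r]`,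
uniqueness of the root in `[1/2, 2]`), granted `DiluteSelfConsistency`; its second hypothesis is
`DiluteSelfConsistency` (packing `ρ_t σ³ < η` along tied classical solutions); its conclusion is
`RelEntropyVanishingLambda`.

Proof route: a PORT of the activity-agnostic dock `LambertianContactSwapLambertianEulerDock.stub_dockLambda`
combined with the `Rf`-docking of the deterministic route
(`EntropyClockDock.clampedWindowDock_of_gronwallRf`):

* the insertion factor is the analytic one of the tree (`stub_eosRatioAnalytic`; continuity on `[0, r]`
  from its Lipschitz clause), the matrix `HU η₀` of `UniformLocalGibbsConcentration` is taken from the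
  tree (`twoClocks_uniformLocalGibbsConcentration_proof`);
* `σ₀ := min σc (min σd (min (1/2) (η₀ ∫a₀ / sup a₀)))` (`σc` from the hypothesis, `σd` from
  `DiluteSelfConsistency` at `η = min η₁ (η₀/2)`, `η₁ := min (r/(8e+4)) (1/(64 e v₁))` the packing
  threshold of `EntropyClockDock.activity_of_density`); the probability clause holds for `σ ≤ 1/2`;
* at `t = 0` the law of `Λ_0` under `λ_N ⊗ γ^ℕ` IS `λ_N`, so the deterministic `t = 0` slice transfers
  (`LambertianContactSwapLambertianEulerDock.lambert_timeZero_slice`);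
* at `t > 0`: mass conservation and unit admissible mass (private re-proofs `integral_density_eq`,
  `integral_density_zero_eq_one`), packing of `ρ_t`, the EXPLICIT inverted activity `a_t`
  (`EntropyClockDock.activity_of_density`: `ρ_t ≤ a_t ≤ 2ρ_t`, `SmallDensity (profileOf a_t) σ`,
  `rhoLim (profileOf a_t) σ = ρ_t`), its `η₀`-diluteness, the reference tie
  (`EntropyClockDock.tie_rhoLim_of_smallDensity`), exponential concentration of the reference around an
  anonymous density pinned to `ρ_t` by `EntropyClockDock.data_eq_of_ties` /
  `EntropyClockDock.tie_of_expConc`, and the KL clause from the first hypothesis.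

References: H.-T. Yau, Lett. Math. Phys. 22 (1991); S. Olla, S. R. S. Varadhan, H.-T. Yau, Comm. Math.
Phys. 155 (1993) §3; C. Kipnis, C. Landim, Scaling Limits of Interacting Particle Systems (1999) Ch. 6;
H. Spohn, Large Scale Dynamics of Interacting Particles (1991) Part I §2.3.

prover-line-stmt-AtomisticToContinuum-11854, line Sketch, stub `stub_dockLambdaRf`.
-/

noncomputable section

namespace Summit.AtomisticToContinuum.HydrodynamicLimit.Theorems.LambertianContactSwapLambertianEulerDockRf

open scoped BigOperators Topology ENNReal InnerProductSpace
open MeasureTheory ProbabilityTheory Filter Set InformationTheory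
open Literature.MathematicalPhysics.KineticTheory
open Literature.Analysis.FluidPDE Literature.Analysis.FluidPDE.Alexander

/-! ### §1 Mass conservation and unit admissible mass (PRIVATE re-proofs) -/

open Literature.Analysis.FunctionSpaces in
-- adapted from `EntropyClockDock.integral_density_eq` (Theorems/TwoClocksClampedWindowDockGronwall.lean, private)
/-- **Mass is conserved** along every classical hard-sphere-Euler solution: `∫ ρ(t) = ∫ ρ(0)` on `[0, T)` (only
the continuity equation is integrated, `∫ div = 0` on the torus). [folklore] -/
private theorem integral_density_eq {σ T : ℝ} {ρ θ : ℝ → T3 → ℝ} {u : ℝ → T3 → V3}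
    (hE : IsHardSphereEulerSolution σ T ρ u θ) {t : ℝ} (ht : t ∈ Ico 0 T) :
    ∫ x, ρ t x = ∫ x, ρ 0 x := by
  have hderiv : ∀ s ∈ Ico 0 T, HasDerivWithinAt (fun s => ∫ x, ρ s x) 0 (Ico 0 T) s := by
    intro s hs
    have h1 := hE.smooth_density.hasDerivWithinAt_integral (convex_Ico 0 T) hs
    have h2 : ∫ x, Torus.timeDerivWithin (Ico 0 T) ρ s x = 0 := by
      have hpt : (fun x => Torus.timeDerivWithin (Ico 0 T) ρ s x) =
          fun x => -Torus.divergence (fun y => ρ s y • u s y) x := by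
        funext x; have := hE.mass s hs x; linarith
      rw [hpt, integral_neg, neg_eq_zero]
      exact Torus.integral_divergence_eq_zero_holds
        ((hE.smooth_density.smul hE.smooth_velocity).isSmooth_slice hs)
    rwa [h2] at h1
  have hcont : ContinuousOn (fun s => ∫ x, ρ s x) (Icc 0 t) := fun s hs =>
    ((hderiv s ⟨hs.1, hs.2.trans_lt ht.2⟩).continuousWithinAt).mono (Icc_subset_Ico_right ht.2)
  have hright : ∀ s ∈ Ico 0 t, HasDerivWithinAt (fun s => ∫ x, ρ s x) 0 (Ici s) s := by
    intro s hs
    have hsT : s ∈ Ico 0 T := ⟨hs.1, hs.2.trans ht.2⟩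
    refine (hderiv s hsT).mono_of_mem_nhdsWithin ?_
    exact Filter.mem_of_superset (Ico_mem_nhdsGE hsT.2) (Ico_subset_Ico_left hsT.1)
  exact constant_of_has_deriv_right_zero hcont hright t (right_mem_Icc.2 ht.1)

-- adapted from `EntropyClockDock.integral_density_zero_eq_one` (ibid., private)
/-- **Admissible mass is one**: the `t = 0` tie tested with `χ ≡ 1` (empirical density identically `1`, laws of
total mass `1` for `σ ≤ 1/2`) forces `∫ ρ(0) = 1`. [folklore] -/
private theorem integral_density_zero_eq_one {σ : ℝ} (hσ2 : σ ≤ 1 / 2) {a₀ θ₀ : T3 → ℝ} {u₀ : T3 → V3}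
    (ha : Continuous a₀) (hθ : Continuous θ₀) (hu : Continuous u₀) (ha0 : ∀ x, 0 < a₀ x)
    (hθ0 : ∀ x, 0 < θ₀ x) {ρ θ : ℝ → T3 → ℝ} {u : ℝ → T3 → V3}
    (Φ : (N : ℕ) → HardSphereFlow (Torus.geometry (Fin 3)) (hsDiameter σ N) (N + 1))
    (hA : TendstoHydroFieldsAt (fun N => localGibbsLaw σ a₀ u₀ θ₀ N (Φ N)) Φ ρ u θ 0) :
    ∫ x, ρ 0 x = 1 := by
  by_contra hne
  have hd : 0 < |1 - ∫ x, ρ 0 x| := abs_pos.2 (sub_ne_zero.2 (Ne.symm hne))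
  have h := (hA (fun _ => 1) continuous_const (|1 - ∫ x, ρ 0 x| / 2) (by positivity)).1
  have hev : ∀ N : ℕ, {z : Config (N + 1) (Fin 3) T3 | |1 - ∫ x, ρ 0 x| / 2 <
      |empiricalDensityField ((Φ N).flow 0 z) (fun _ => 1) - ∫ x, (fun _ => (1 : ℝ)) x * ρ 0 x|} = univ := by
    intro N
    ext z
    simp only [mem_setOf_eq, mem_univ, iff_true, empiricalDensityField_one (Nat.succ_ne_zero N), one_mul]
    linarith
  have hP : ∀ N, IsProbabilityMeasure (localGibbsLaw σ a₀ u₀ θ₀ N (Φ N)) :=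
    fun N => isProbabilityMeasure_localGibbsLaw ha hθ hu ha0 hθ0 hσ2 N (Φ N)
  simp only [hev, measure_univ] at h
  exact one_ne_zero (tendsto_nhds_unique (tendsto_const_nhds (x := (1 : ℝ≥0∞)) (f := atTop)) h)

/-! ### §2 The dock along the explicit reference: `GronwallCoreLambdaRf → DiluteSelfConsistency → RelEntropyVanishingLambda` -/

/-- **The entropy-clock DOCK of the Lambertian gas along the EXPLICIT reference** (stub `stub_dockLambdaRf`
of line `Sketch`): Yau's node `RelEntropyVanishingLambda` follows from Yau's relative-entropy estimate along
the explicit reference family — for EVERY insertion factor `Rf` on `(-r, r)` (handed over with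
`Rf x · Φ(x Rf x) = 1` and `0 < Rf` on `(-r, r)`, `1 ≤ Rf ≤ 2` and continuity on `[0, r]`, uniqueness of the
root of `R · Φ(xR) = 1` in `[1/2, 2]`) and granted `DiluteSelfConsistency`, for continuous positive
profiles there is `σ₀ > 0` such that for `0 < σ < σ₀`, every classical solution tied at `t = 0`, every flow
family `Φ`, every `t ∈ (0, T)`, with `a_t := fun x => ρ t x * Rf (σ ^ 3 * ρ t x)` continuous, positive,
`ρ_t ≤ a_t ≤ 2ρ_t`, `SmallDensity (profileOf a_t) σ`, `rhoLim (profileOf a_t) σ = ρ_t`, the specific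
relative entropy of the law of `Λ_t` under `λ_N ⊗ γ^ℕ` with respect to
`localGibbsLaw σ a_t (u t) (θ t) N (Φ N)` vanishes — and from `DiluteSelfConsistency`. Discharged here: the
insertion factor (`stub_eosRatioAnalytic`), the probability clause (`σ ≤ 1/2`), the `t = 0` slice
(`lambert_timeZero_slice`), the choice of `σ₀`, mass conservation and unit mass, the packing of `ρ_t` at
`η = min η₁ (η₀/2)`, the explicit inverted activity (`EntropyClockDock.activity_of_density`) with its
`η₀`-diluteness and its tie (`EntropyClockDock.tie_rhoLim_of_smallDensity`), and the exponential
concentration of the reference around the Euler fields (the matrix of `UniformLocalGibbsConcentration` from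
the tree, its anonymous density pinned to `ρ_t` by `EntropyClockDock.data_eq_of_ties`). Port of
`LambertianContactSwapLambertianEulerDock.stub_dockLambda` through
`EntropyClockDock.clampedWindowDock_of_gronwallRf`. [folklore] -/
theorem stub_dockLambdaRf :
    (∀ (r : ℝ) (Rf : ℝ → ℝ), 0 < r →
        (∀ x ∈ Set.Ioo (-r) r, 0 < Rf x ∧ Rf x * (∑' j : ℕ, bE j / (j.factorial : ℝ) * (x * Rf x) ^ j) = 1) →
        (∀ x ∈ Set.Icc 0 r, 1 ≤ Rf x ∧ Rf x ≤ 2) → ContinuousOn Rf (Set.Icc 0 r) →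
        (∀ x ∈ Set.Ioo (-r) r, ∀ R ∈ Set.Icc (1 / 2 : ℝ) 2,
          R * (∑' j : ℕ, bE j / (j.factorial : ℝ) * (x * R) ^ j) = 1 → R = Rf x) →
      (∀ η : ℝ, 0 < η → ∀ (a₀ θ₀ : T3 → ℝ) (u₀ : T3 → V3), Continuous a₀ → Continuous θ₀ → Continuous u₀ → (∀ x, 0 < a₀ x) → (∀ x, 0 < θ₀ x) → ∃ σ₀ : ℝ, 0 < σ₀ ∧ ∀ σ : ℝ, 0 < σ → σ < σ₀ → ∀ (T : ℝ) (ρ θ : ℝ → T3 → ℝ) (u : ℝ → T3 → V3), IsHardSphereEulerSolution σ T ρ u θ → ∀ Φ : (N : ℕ) → HardSphereFlow (Torus.geometry (Fin 3)) (hsDiameter σ N) (N + 1), TendstoHydroFieldsAt (fun N => localGibbsLaw σ a₀ u₀ θ₀ N (Φ N)) Φ ρ u θ 0 → ∀ t ∈ Set.Ico 0 T, ∀ x, ρ t x * σ ^ 3 < η) →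
      ∀ (a₀ θ₀ : T3 → ℝ) (u₀ : T3 → V3), Continuous a₀ → Continuous θ₀ → Continuous u₀ →
        (∀ x, 0 < a₀ x) → (∀ x, 0 < θ₀ x) →
        ∃ σ₀ : ℝ, 0 < σ₀ ∧ ∀ σ : ℝ, 0 < σ → σ < σ₀ →
          ∀ (T : ℝ) (ρ θ : ℝ → T3 → ℝ) (u : ℝ → T3 → V3), IsHardSphereEulerSolution σ T ρ u θ →
            ∀ Φ : (N : ℕ) → HardSphereFlow (Torus.geometry (Fin 3)) (hsDiameter σ N) (N + 1),
              TendstoHydroFieldsAt (fun N => localGibbsLaw σ a₀ u₀ θ₀ N (Φ N)) Φ ρ u θ 0 →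
              ∀ t ∈ Set.Ioo 0 T, ∀ (hac : Continuous fun x => ρ t x * Rf (σ ^ 3 * ρ t x))
                (hap : ∀ x, 0 < ρ t x * Rf (σ ^ 3 * ρ t x)),
                (∀ x, ρ t x ≤ ρ t x * Rf (σ ^ 3 * ρ t x) ∧ ρ t x * Rf (σ ^ 3 * ρ t x) ≤ 2 * ρ t x) →
                SmallDensity (profileOf (fun x => ρ t x * Rf (σ ^ 3 * ρ t x)) hac hap) σ →
                rhoLim (profileOf (fun x => ρ t x * Rf (σ ^ 3 * ρ t x)) hac hap) σ = ρ t →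
                Tendsto (fun N : ℕ => klDiv (((localGibbsLaw σ a₀ u₀ θ₀ N (Φ N)).prod (lambertNoise (Fin 3))).map
                        (fun p => lambertFlow (Torus.geometry (Fin 3)) (hsDiameter σ N) p.2 p.1 t))
                  (localGibbsLaw σ (fun x => ρ t x * Rf (σ ^ 3 * ρ t x)) (u t) (θ t) N (Φ N)) / ((N : ℝ≥0∞) + 1)) atTop (𝓝 0)) →
    (∀ η : ℝ, 0 < η → ∀ (a₀ θ₀ : T3 → ℝ) (u₀ : T3 → V3), Continuous a₀ → Continuous θ₀ → Continuous u₀ → (∀ x, 0 < a₀ x) → (∀ x, 0 < θ₀ x) → ∃ σ₀ : ℝ, 0 < σ₀ ∧ ∀ σ : ℝ, 0 < σ → σ < σ₀ → ∀ (T : ℝ) (ρ θ : ℝ → T3 → ℝ) (u : ℝ → T3 → V3), IsHardSphereEulerSolution σ T ρ u θ → ∀ Φ : (N : ℕ) → HardSphereFlow (Torus.geometry (Fin 3)) (hsDiameter σ N) (N + 1), TendstoHydroFieldsAt (fun N => localGibbsLaw σ a₀ u₀ θ₀ N (Φ N)) Φ ρ u θ 0 → ∀ t ∈ Set.Ico 0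 T, ∀ x, ρ t x * σ ^ 3 < η) →
        ∀ (a₀ θ₀ : Literature.MathematicalPhysics.KineticTheory.T3 → ℝ) (u₀ : Literature.MathematicalPhysics.KineticTheory.T3 → Literature.MathematicalPhysics.KineticTheory.V3), Continuous a₀ → Continuous θ₀ → Continuous u₀ → (∀ x, 0 < a₀ x) → (∀ x, 0 < θ₀ x) → ∃ σ₀ : ℝ, 0 < σ₀ ∧ ∀ σ : ℝ, 0 < σ → σ < σ₀ → ∀ (T : ℝ) (ρ θ : ℝ → Literature.MathematicalPhysics.KineticTheory.T3 → ℝ) (u : ℝ → Literature.MathematicalPhysics.KineticTheory.T3 → Literature.MathematicalPhysics.KineticTheory.V3), Literature.MathematicalPhysics.KineticTheory.IsHardSphereEulerSolution σ T ρ u θ → ∀ Φ : (N : ℕ) → Literature.Analysis.FluidPDE.HardSphereFlow (Literature.Analysis.FluidPDE.Torus.geometry (Fin 3)) (Literature.MathematicalPhysics.KineticTheory.hsDiameter σ N) (N + 1), (∀ N, MeasureTheory.IsProbabilityMeasure (Literature.MathematicalPhysics.KineticTheory.localGibbsLaw σ a₀ u₀ θ₀ N (Φ N))) ∧ (Literature.MathematicalPhysics.KineticTheory.TendstoHydroFieldsAt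 (fun N => Literature.MathematicalPhysics.KineticTheory.localGibbsLaw σ a₀ u₀ θ₀ N (Φ N)) Φ ρ u θ 0 → ∀ t ∈ Set.Ico 0 T, ∃ a : Literature.MathematicalPhysics.KineticTheory.T3 → ℝ, (∀ N, MeasureTheory.IsProbabilityMeasure (Literature.MathematicalPhysics.KineticTheory.localGibbsLaw σ a (u t) (θ t) N (Φ N))) ∧ (∀ χ : Literature.MathematicalPhysics.KineticTheory.T3 → ℝ, Continuous χ → ∀ δ : ℝ, 0 < δ → ∃ C : ℝ, 0 < C ∧ ∀ N : ℕ, Literature.MathematicalPhysics.KineticTheory.localGibbsLaw σ a (u t) (θ t) N (Φ N) {z | δ < |Literature.MathematicalPhysics.KineticTheory.empiricalDensityField z χ - ∫ x, χ x * ρ t x|} ≤ ENNReal.ofReal (C * Real.exp (-(C⁻¹ * (N + 1)))) ∧ Literature.MathematicalPhysics.KineticTheory.localGibbsLaw σ a (u t) (θ t) N (Φ N) {z | δ < ‖Literature.MathematicalPhysics.KineticTheory.empiricalMomentumField z χ - ∫ x, (χ x * ρ t x) • u t x‖} ≤ ENNReal.ofReal (C * Real.exp (-(C⁻¹ * (N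 + 1)))) ∧ Literature.MathematicalPhysics.KineticTheory.localGibbsLaw σ a (u t) (θ t) N (Φ N) {z | δ < |Literature.MathematicalPhysics.KineticTheory.empiricalEnergyField z χ - ∫ x, χ x * Literature.MathematicalPhysics.KineticTheory.totalEnergyDensity (ρ t x) (u t x) (θ t x)|} ≤ ENNReal.ofReal (C * Real.exp (-(C⁻¹ * (N + 1))))) ∧ Filter.Tendsto (fun N : ℕ => InformationTheory.klDiv (((Literature.MathematicalPhysics.KineticTheory.localGibbsLaw σ a₀ u₀ θ₀ N (Φ N)).prod (Literature.MathematicalPhysics.KineticTheory.lambertNoise (Fin 3))).map (fun p => Literature.MathematicalPhysics.KineticTheory.lambertFlow (Literature.Analysis.FluidPDE.Torus.geometry (Fin 3)) (Literature.MathematicalPhysics.KineticTheory.hsDiameter σ N) p.2 p.1 t)) (Literature.MathematicalPhysics.KineticTheory.localGibbsLaw σ a (u t) (θ t) N (Φ N)) / ((N : ENNReal) + 1)) Filter.atTop (nhds 0)) := by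
  intro gronwall hS a₀ θ₀ u₀ ha hθ hu ha0 hθ0
  -- the analytic insertion factor of the hard-sphere gas
  obtain ⟨r, hr, Rf, -, -, -, hsol, hbd, hLip, huniq⟩ := stub_eosRatioAnalytic
  have hcont : ContinuousOn Rf (Icc 0 r) := by
    obtain ⟨L, hL⟩ := hLip
    exact hL.continuousOn
  -- the matrix of `UniformLocalGibbsConcentration` from the tree
  obtain ⟨η₀, hη₀, HU⟩ := twoClocks_uniformLocalGibbsConcentration_proof
  obtain ⟨σc, hσc, Hc⟩ := gronwall r Rf hr hsol hbd hcont huniq hS a₀ θ₀ u₀ ha hθ hu ha0 hθ0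
  -- the packing threshold of `EntropyClockDock.activity_of_density`
  set η₁ : ℝ := min (r / (2 * (2 * (2 * Real.exp 1 + 1)))) (1 / (64 * Real.exp 1 * v₁)) with hη₁
  have hη₁ : 0 < η₁ := lt_min (by positivity) (by have := v₁_pos; positivity)
  -- dilute self-consistency at `η = min η₁ (η₀/2)`
  obtain ⟨σd, hσd, Hd⟩ := hS (min η₁ (η₀ / 2)) (lt_min hη₁ (by positivity)) a₀ θ₀ u₀ ha hθ hu ha0 hθ0
  -- the initial activity is `η₀`-dilute for `σ ≤ min (1/2) (η₀ ∫a₀ / sup a₀)`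
  have hI : 0 < ∫ x, a₀ x := integral_pos_of_continuous_pos ha ha0
  have hbdd₀ : BddAbove (Set.range a₀) := (isCompact_range ha).bddAbove
  have hSpos : 0 < ⨆ x, a₀ x := (ha0 0).trans_le (le_ciSup hbdd₀ 0)
  have hg : 0 < η₀ * (∫ x, a₀ x) / ⨆ x, a₀ x := div_pos (mul_pos hη₀ hI) hSpos
  refine ⟨min σc (min σd (min (1 / 2) (η₀ * (∫ x, a₀ x) / ⨆ x, a₀ x))),
    lt_min hσc (lt_min hσd (lt_min (by norm_num) hg)), fun σ hσ hσlt T ρ θ u hE Φ => ?_⟩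
  have hσc' : σ < σc := hσlt.trans_le (min_le_left _ _)
  have hσd' : σ < σd := hσlt.trans_le ((min_le_right _ _).trans (min_le_left _ _))
  have hσ2' : σ < 1 / 2 :=
    hσlt.trans_le ((min_le_right _ _).trans ((min_le_right _ _).trans (min_le_left _ _)))
  have hσ2 : σ ≤ 1 / 2 := hσ2'.le
  have hσg : σ ≤ η₀ * (∫ x, a₀ x) / ⨆ x, a₀ x :=
    (hσlt.trans_le ((min_le_right _ _).trans ((min_le_right _ _).trans (min_le_right _ _)))).le
  have hguard : σ ^ 3 * (⨆ x, a₀ x) ≤ η₀ * ∫ x, a₀ x := by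
    have h31 : σ ^ 3 ≤ σ := pow_le_of_le_one hσ.le (hσ2.trans (by norm_num)) three_ne_zero
    calc σ ^ 3 * (⨆ x, a₀ x) ≤ σ * ⨆ x, a₀ x := mul_le_mul_of_nonneg_right h31 hSpos.le
      _ ≤ η₀ * (∫ x, a₀ x) / (⨆ x, a₀ x) * ⨆ x, a₀ x := mul_le_mul_of_nonneg_right hσg hSpos.le
      _ = η₀ * ∫ x, a₀ x := div_mul_cancel₀ _ hSpos.ne'
  refine ⟨fun N => isProbabilityMeasure_localGibbsLaw ha hθ hu ha0 hθ0 hσ2 N (Φ N), fun htie t ht => ?_⟩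
  obtain ⟨ρ₀, hρ₀c, hρ₀pos, -, hconc⟩ := HU a₀ θ₀ u₀ ha hθ hu ha0 hθ0 σ hσ hguard
  rcases ht.1.eq_or_lt with h0 | htpos
  · subst h0
    exact LambertianContactSwapLambertianEulerDock.lambert_timeZero_slice hσ hσ2' ha hθ hu ha0 hθ0 hρ₀c
      hρ₀pos hconc hE ht.2 Φ htie
  · -- the Euler slice at time `t`
    have hρtc : Continuous (ρ t) := (hE.smooth_density.isSmooth_slice ht).continuous
    have hutc : Continuous (u t) := (hE.smooth_velocity.isSmooth_slice ht).continuous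
    have hθtc : Continuous (θ t) := (hE.smooth_temperature.isSmooth_slice ht).continuous
    have hρtpos : ∀ x, 0 < ρ t x := hE.density_pos t ht
    have hθtpos : ∀ x, 0 < θ t x := hE.temperature_pos t ht
    have hmass : ∫ x, ρ t x = 1 :=
      (integral_density_eq hE ht).trans (integral_density_zero_eq_one hσ2 ha hθ hu ha0 hθ0 Φ htie)
    -- packing of `ρ_t` from dilute self-consistency
    have hpack : ∀ x, ρ t x * σ ^ 3 < min η₁ (η₀ / 2) := fun x => Hd σ hσ hσd' T ρ θ u hE Φ htie t ht x
    have hbdd : BddAbove (Set.range (ρ t)) := (isCompact_range hρtc).bddAbove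
    obtain ⟨xM, -, hxM⟩ := isCompact_univ.exists_isMaxOn univ_nonempty hρtc.continuousOn
    have hsup : (⨆ x, ρ t x) = ρ t xM :=
      le_antisymm (ciSup_le fun x => (isMaxOn_iff.mp hxM) x (mem_univ x)) (le_ciSup hbdd xM)
    have hpack₁ : σ ^ 3 * (⨆ x, ρ t x) ≤ η₁ := by
      rw [hsup, mul_comm]; exact ((hpack xM).trans_le (min_le_left _ _)).le
    have hpack₀ : σ ^ 3 * (⨆ x, ρ t x) ≤ η₀ / 2 := by
      rw [hsup, mul_comm]; exact ((hpack xM).trans_le (min_le_right _ _)).le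
    -- the EXPLICIT inverted activity `a_t = ρ_t · Rf(σ³ ρ_t)`
    obtain ⟨hac, hap, hale, hQs, hlim⟩ :=
      EntropyClockDock.activity_of_density hr hsol hbd hcont huniq hσ hσ2' hρtc hρtpos hmass hpack₁
    -- `η₀`-diluteness of `a_t`: `σ³ sup a_t ≤ 2 σ³ sup ρ_t ≤ η₀ ≤ η₀ ∫a_t`
    have haguard : σ ^ 3 * (⨆ x, ρ t x * Rf (σ ^ 3 * ρ t x)) ≤
        η₀ * ∫ x, ρ t x * Rf (σ ^ 3 * ρ t x) := by
      have hsupa : (⨆ x, ρ t x * Rf (σ ^ 3 * ρ t x)) ≤ 2 * ⨆ x, ρ t x :=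
        ciSup_le fun x => (hale x).2.trans (mul_le_mul_of_nonneg_left (le_ciSup hbdd x) zero_le_two)
      have hinta : 1 ≤ ∫ x, ρ t x * Rf (σ ^ 3 * ρ t x) := by
        have h := integral_mono (integrable_of_continuous_T3 hρtc) (integrable_of_continuous_T3 hac)
          fun x => (hale x).1
        linarith [hmass]
      have hσ3 : 0 ≤ σ ^ 3 := by positivity
      calc σ ^ 3 * (⨆ x, ρ t x * Rf (σ ^ 3 * ρ t x)) ≤ σ ^ 3 * (2 * ⨆ x, ρ t x) :=
            mul_le_mul_of_nonneg_left hsupa hσ3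
        _ = 2 * (σ ^ 3 * ⨆ x, ρ t x) := by ring
        _ ≤ 2 * (η₀ / 2) := by gcongr
        _ = η₀ * 1 := by ring
        _ ≤ η₀ * ∫ x, ρ t x * Rf (σ ^ 3 * ρ t x) := mul_le_mul_of_nonneg_left hinta hη₀.le
    -- the reference: probability and exponential concentration around an anonymous density `ρ₁`
    obtain ⟨ρ₁, hρ₁c, hρ₁pos, hprob, hconc₁⟩ :=
      HU (fun x => ρ t x * Rf (σ ^ 3 * ρ t x)) (θ t) (u t) hac hθtc hutc hap hθtpos σ hσ haguard
    -- the reference tie: `rhoLim (profileOf a_t) σ = ρ_t`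
    have hatie : TendstoHydroFieldsAt
        (fun N => localGibbsLaw σ (fun x => ρ t x * Rf (σ ^ 3 * ρ t x)) (u t) (θ t) N (Φ N)) Φ
        (fun _ => ρ t) (fun _ => u t) (fun _ => θ t) 0 := by
      have h := EntropyClockDock.tie_rhoLim_of_smallDensity (u₀ := u t) hac hθtc hutc hap hθtpos hσ2 hQs Φ
      simp only [hlim] at h
      exact h
    -- pin the anonymous LLN density `ρ₁` of the reference to the Euler density `ρ t`
    obtain ⟨hρt, -, -⟩ := EntropyClockDock.data_eq_of_ties hσ2 Φ hac hθtc hutc hap hθtpos hρ₁c hρ₁pos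
      (EntropyClockDock.tie_of_expConc Φ hconc₁) (ρ := fun _ => ρ t) (u := fun _ => u t)
      (θ := fun _ => θ t) hρtc hutc hθtc hatie
    refine ⟨fun x => ρ t x * Rf (σ ^ 3 * ρ t x), fun N => hprob N (Φ N), fun χ hχ δ hδ => ?_,
      Hc σ hσ hσc' T ρ θ u hE Φ htie t ⟨htpos, ht.2⟩ hac hap hale hQs hlim⟩
    obtain ⟨C, hC, hN⟩ := hconc₁ χ hχ δ hδ
    refine ⟨C, hC, fun N => ?_⟩
    have h := hN N (Φ N)
    rw [← hρt] at h
    exact h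

end Summit.AtomisticToContinuum.HydrodynamicLimit.Theorems.LambertianContactSwapLambertianEulerDockRf

end
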